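import Summits.Ventures.HodgeRepro.Night1ReducedPullback

/-!
# The pull-back of an ORBIT CLASS: the `σ`-component of `m^* ω` for `ω = Σ_S c_S e_S` is `c_{U_σ} · (±1) · w_σ`
— LEMMA-R-RESIDUE.md §5's last sentence on night-1's kernel model

Blind re-derivation cell `pub-hodge-repro`, seat `t3-p4` (Tier 3, T3.5 for T3.4).  Target tree path
`lean/Summits/Ventures/HodgeRepro/Tier3OrbitPullback.lean`; imports night-1's `Night1ReducedPullback` (the pull-back
`pullLin (twistMap cls tw)` on coordinate wedges, the component projections `wedgeComponent`, the `σ`-lines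
`weilWedgeProd e σ` and the reduced wedges `e_{U_σ}`; namespace `HodgeRepro.RouteC`, with typer-2's `coordWedgeOn` /
`reducedSet` in `HodgeRepro.CMHodgeOn` / `HodgeRepro`).

WHAT THIS FILE STATES.  Night-1's `wedgeComponent_lineEnum_map_pullLin_reducedWedge` says: the `lineSet σ`-component
of the pull-back of the reduced wedge `e_{U_σ}` of `B_red` is the `σ`-line `w_σ` of `W_F(B)` — one class `e_{U_σ}`
per `σ`.  Lemma R needs ONE rational class `η` whose pull-back has a non-zero `σ`-component for EVERY `σ`
(LEMMA-R-RESIDUE.md §5: `η = Σ_U c_U e_U` over the Galois orbit of reduced sets with every `c_U ≠ 0`, produced on the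
kernel by `Tier3WedgeChain.exists_eigenbasis_wedge_chain`; then «`e · m^* η = Σ_U c_U Σ_{σ : U_σ = U} (± w_σ)` … is
non-zero»).  Here is that computation in night-1's vocabulary, for an arbitrary combination
`ω = Σ_{S ∈ T} c_S · e_S` of the canonical wedges `sizedWedge S` of DISTINCT `2k`-subsets `S` of `J × G`:

* `wedgeComponent_lineEnum_map_pullLin_coordWedgeOn_of_ne`: the `σ`-component of the pull-back of a coordinate wedge
  whose set is NOT `U_σ` vanishes (every lift of its enumeration misses the `σ`-line);
* `exists_sign_wedgeComponent_lineEnum_map_pullLin_sum`: the `σ`-component of `m^* ω` is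
  `(c_{U_σ} · ε_σ) • w_σ` with `ε_σ ∈ {1, −1}` (the sign relating night-1's enumeration `reducedEnum cls tw e σ` of
  `U_σ` to the canonical one), where `c_{U_σ} := c S` for the `S ∈ T` with `S = U_σ` and `0` if `U_σ ∉ T`;
* `wedgeComponent_lineEnum_map_pullLin_sum_ne_zero`: hence it is NON-ZERO as soon as `U_σ ∈ T` and `c_{U_σ} ≠ 0` —
  «every `c_U ≠ 0` ⇒ every `σ`-component of `m^* η` is a non-zero multiple of `w_σ`», the sentence of §5.

HONESTY.  Linear algebra on the cell's own kernel model (finite `G`-sets, coordinate wedges over `ℂ`); nothing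
geometric is built and nothing here is about Hodge classes beyond the abstract statement.  HC_CM is NOT proved by
anyone in this repository.
-/

set_option autoImplicit false

open Finset

namespace HodgeRepro.Tier3

open HodgeRepro.RouteC HodgeRepro.CMHodgeOn

variable {G : Type*} [Group G] [DecidableEq G] [Fintype G] {ι J : Type*} [Fintype ι] [DecidableEq ι]
  [DecidableEq J]

/-- **The `σ`-component of the pull-back of a wedge whose set is not `U_σ` vanishes**: for an injective
enumeration `u` of a `2k`-set `≠ reducedSet cls tw σ`, `wedgeComponent (lineEnum e σ) (m^* e_u) = 0` — no lift of `u`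
along the twist map has the `σ`-line as its set. -/
theorem wedgeComponent_lineEnum_map_pullLin_coordWedgeOn_of_ne {cls : ι → J} {tw : ι → G} {k : ℕ}
    (e : Fin (2 * k) ≃ ι) (σ : G) {u : Fin (2 * k) → J × G} (hu : Function.Injective u)
    (hne : univ.image u ≠ reducedSet cls tw σ) :
    wedgeComponent (lineEnum e σ)
      (exteriorPower.map (2 * k) (pullLin (twistMap cls tw)) (coordWedgeOn (2 * k) u)) = 0 := by
  rw [wedgeComponent_apply, map_pullLin_coordWedgeOn, map_sum, Finset.sum_eq_zero, zero_smul]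
  intro ℓ hℓ
  have hθℓ : twistMap cls tw ∘ ℓ = u := by
    funext j
    have := (Fintype.mem_piFinset.mp hℓ) j
    simpa using this
  have hℓinj : Function.Injective ℓ := by
    intro a b h
    apply hu
    rw [← hθℓ]
    simp [h]
  apply setDual_coordWedgeOn_of_image_ne (lineEnum_injective e σ) hℓinj
  intro himg
  apply hne
  rw [← hθℓ, ← Finset.image_image, ← himg, image_lineEnum, image_lineSet_twistMap]

/-- **The `σ`-component of the pull-back of an orbit class.**  For `(cls, tw)` injective, `ω = Σ_{S ∈ T} c S • e_S`
a combination of the canonical wedges of distinct `2k`-subsets `S` of `J × G`, and `U : SizedSets (J × G) (2k)` the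
reduced set `U_σ`: `wedgeComponent (lineEnum e σ) (m^* ω) = ((if U ∈ T then c U else 0) · ε) • w_σ` for a sign
`ε ∈ {1, −1}` (independent of `T` and `c`). -/
theorem exists_sign_wedgeComponent_lineEnum_map_pullLin_sum {cls : ι → J} {tw : ι → G}
    (hinj : Function.Injective fun i => (cls i, tw i)) {k : ℕ} (e : Fin (2 * k) ≃ ι) (σ : G)
    (U : SizedSets (J × G) (2 * k)) (hU : U.1 = reducedSet cls tw σ) :
    ∃ ε : ℂ, (ε = 1 ∨ ε = -1) ∧
      ∀ (T : Finset (SizedSets (J × G) (2 * k))) (c : SizedSets (J × G) (2 * k) → ℂ),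
        wedgeComponent (lineEnum e σ)
          (exteriorPower.map (2 * k) (pullLin (twistMap cls tw)) (∑ S ∈ T, c S • sizedWedge S)) =
          ((if U ∈ T then c U else 0) * ε) • weilWedgeProd e σ := by
  classical
  -- the canonical wedge of `U_σ` is `± e_{reducedEnum σ}`
  obtain ⟨π, hπ⟩ := coordWedgeOn_eq_sign_smul_of_image_eq (reducedEnum_injective hinj e σ)
    (setEnum_injective U.1 U.2) (by rw [image_reducedEnum, image_setEnum, hU])
  refine ⟨((Equiv.Perm.sign π : ℤ) : ℂ), ?_, ?_⟩
  · rcases Int.units_eq_one_or (Equiv.Perm.sign π) with h | h <;> simp [h]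
  intro T c
  simp only [map_sum, map_smul]
  have hvan : ∀ S ∈ T, S ≠ U → c S • wedgeComponent (lineEnum e σ)
      (exteriorPower.map (2 * k) (pullLin (twistMap cls tw)) (sizedWedge S)) = 0 := by
    intro S _ hSU
    rw [sizedWedge, wedgeComponent_lineEnum_map_pullLin_coordWedgeOn_of_ne e σ (setEnum_injective S.1 S.2),
      smul_zero]
    rw [image_setEnum, ← hU]
    exact fun h => hSU (Subtype.ext h)
  by_cases hUT : U ∈ T
  · rw [Finset.sum_eq_single_of_mem U hUT hvan, if_pos hUT, sizedWedge, hπ, map_smul, map_smul,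
      wedgeComponent_lineEnum_map_pullLin_reducedWedge hinj e σ, smul_smul]
  · rw [Finset.sum_eq_zero (fun S hS => hvan S hS (fun h => hUT (h ▸ hS))), if_neg hUT, zero_mul, zero_smul]

/-- **The sentence of LEMMA-R-RESIDUE.md §5 on the kernel model**: if the orbit class `ω = Σ_{S ∈ T} c S • e_S` has
`U_σ ∈ T` with `c_{U_σ} ≠ 0`, the `σ`-component of `m^* ω` is non-zero (a non-zero multiple of the `σ`-line `w_σ`). -/
theorem wedgeComponent_lineEnum_map_pullLin_sum_ne_zero {cls : ι → J} {tw : ι → G}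
    (hinj : Function.Injective fun i => (cls i, tw i)) {k : ℕ} (e : Fin (2 * k) ≃ ι) (σ : G)
    (U : SizedSets (J × G) (2 * k)) (hU : U.1 = reducedSet cls tw σ)
    (T : Finset (SizedSets (J × G) (2 * k))) (c : SizedSets (J × G) (2 * k) → ℂ) (hUT : U ∈ T)
    (hc : c U ≠ 0) :
    wedgeComponent (lineEnum e σ)
      (exteriorPower.map (2 * k) (pullLin (twistMap cls tw)) (∑ S ∈ T, c S • sizedWedge S)) ≠ 0 := by
  obtain ⟨ε, hε, h⟩ := exists_sign_wedgeComponent_lineEnum_map_pullLin_sum hinj e σ U hU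
  rw [h T c, if_pos hUT]
  refine smul_ne_zero (mul_ne_zero hc ?_) (weilWedgeProd_ne_zero e σ)
  rcases hε with rfl | rfl <;> simp

end HodgeRepro.Tier3
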